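import Mathlib
import Literature.NumberTheory.Automorphic.ResGLnConeDictionary
import Summits.Langlands.Langlands.Theorems.IrreducibilityBySelfDualityHeckeEigenvalueFieldStubDictW4
import Summits.Langlands.Langlands.Theorems.IrreducibilityBySelfDualityHeckeEigenvalueFieldStubDictW5
import HarnessLib

/-!
# The twisted evaluation of a fixed tensor is smooth in the matrix coordinates of `G_∞`, with
derivative the Leibniz action — crux HeckeEigenvalueField (stmt-Langlands-13632), line Sketch,
stub DICT-W7

Statement.  Let `K` be a number field, `K_∞ = mixedSpace K`, `M = M_n(K_∞)` (operator norm),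
`G_∞ = GL_n(K_∞)` the archimedean group of the datum `𝒟 = AutomorphyDatum.gl n K hcpt` (Lie algebra
`𝔤 = M`), `π = W / W'` an automorphic representation of `GL_n(𝔸_K)` (`W` a space of automorphic
functions, `X ∈ 𝔤` acting by the Lie derivative `π.lieRepW X`), `E = E_λ(ℂ) ⊗ ε_S` the coefficient
representation `σS` of `G_∞` with differential `σ𝔤S`, `c ∈ GL_n(𝔸_K^∞)` a finite-adelic point and
`(m, c) = m_∞ · c_f ∈ GL_n(𝔸_K)` (`ConeDictionary.adelicPt`, the matrix `m` read in `G_∞` through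
`GLn.archOfMatrix`, junk `1` off the invertible matrices).  For a FIXED tensor `t ∈ W ⊗_ℂ E` the twisted
evaluation `F_t : m ↦ E(m) · t(m, c)` (`t(y) = evalTensor t y`, `(ψ ⊗ e)(y) = ψ(y) e`) is `C^∞` at
every invertible `m₀`, and its flat derivative along `m₀ X` is the twisted evaluation at `m₀` of
`X · t`, where `X` acts on `W ⊗ E` by the Leibniz rule `X ⊗ 1 + 1 ⊗ dE(X)` (`GKTensor.lie`):
`D F_t(m₀)(m₀ X) = E(m₀) · (X · t)(m₀, c)`.

Proof.  Both sides are additive in `t` (`evalTensor`, `E(m)` and `X ·` are linear; `fderiv_add`), and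
vanish for `t = 0`, so by induction on the tensor product it suffices to treat a pure tensor
`t = ψ ⊗ e`.  Then `F_t(m) = ψ(c · m) • E(m) e` (`m_∞` and `c_f` commute in `GL_n(𝔸_K)`), the product
of the scalar function `f(m) = ψ(c · m)` — smooth at `m₀` with `D f(m₀)(m₀ X) = (X ψ)(c · m₀)` since
`ψ ∈ W` is smooth in the archimedean variable (stub DICT-W4, `stub_isArchSmooth_contDiffAt_matrix`) —
and the vector function `v(m) = E(m) e` — smooth at `m₀` with `D v(m₀)(m₀ X) = E(m₀) dE(X) e`
(stub DICT-W5, `stub_isDifferentiableRep_contDiffAt_matrix`, `E` being a finite-dimensional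
differentiable representation).  By the product rule (`fderiv_fun_smul`)
`D F_t(m₀)(m₀ X) = ψ(c m₀) • E(m₀) dE(X) e + (X ψ)(c m₀) • E(m₀) e`, which is
`E(m₀) · ((X ψ) ⊗ e + ψ ⊗ dE(X) e)(m₀, c) = E(m₀) · (X · (ψ ⊗ e))(m₀, c)`.
Borel–Wallach 2000, VII 2.2; Borel–Jacquet 1979, §1.5.
-/

set_option linter.dupNamespace false -- project-wide: `Summit.Langlands.Langlands` is the mandated namespace

noncomputable section

open scoped Matrix.Norms.Operator ContDiff Topology TensorProduct Classical
open Filter NumberField NumberField.mixedEmbedding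
open Literature.NumberTheory.Automorphic Literature.NumberTheory.Automorphic.RealMatrixGroup

-- Mathlib idiom (as in `GKModules`): commutator bracket on `Module.End` / matrix algebras
attribute [local instance 100] LieRing.ofAssociativeRing

namespace Summit.Langlands.Langlands.Theorems.HeckeEigenvalueField.Res

/-- On an invertible matrix `m₀`, `GLn.archOfMatrix n K m₀` is the unit `m₀`. [folklore] -/
private theorem archOfMatrix_of_isUnit {n : ℕ} {K : Type} [Field K] [NumberField K]
    {m₀ : Matrix (Fin n) (Fin n) (mixedSpace K)} (hm₀ : IsUnit m₀) :
    GLn.archOfMatrix n K m₀ = ⟨hm₀.unit, Subgroup.mem_top _⟩ :=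
  dif_pos hm₀

/-- Sum rule, in the shape used below: a function `H` which is (pointwise) the sum `F + G` of two
functions smooth at `x₀` is smooth at `x₀`, and `DH(x₀) v = DF(x₀) v + DG(x₀) v` (the values of the
two derivatives being given). [folklore] -/
private theorem contDiffAt_fderiv_add {V E' : Type*} [NormedAddCommGroup V] [NormedSpace ℝ V]
    [NormedAddCommGroup E'] [NormedSpace ℝ E'] {H F G : V → E'} {x₀ v : V} {a b : E'}
    (hF : ContDiffAt ℝ ∞ F x₀) (hG : ContDiffAt ℝ ∞ G x₀) (hH : H = fun x => F x + G x)
    (ha : fderiv ℝ F x₀ v = a) (hb : fderiv ℝ G x₀ v = b) :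
    ContDiffAt ℝ ∞ H x₀ ∧ fderiv ℝ H x₀ v = a + b := by
  subst hH
  refine ⟨hF.add hG, ?_⟩
  rw [fderiv_fun_add (hF.differentiableAt (by simp)) (hG.differentiableAt (by simp)), add_apply,
    ha, hb]

/-- Product rule for a complex scalar function and a vector function on a real normed space, in
the shape used below: a function `H` which is (pointwise) the product `f • G` of two functions
smooth at `x₀` is smooth at `x₀`, and `DH(x₀) v = f(x₀) • DG(x₀) v + (Df(x₀) v) • G(x₀)` (the
values of the two derivatives being given). [folklore] -/
private theorem contDiffAt_fderiv_smul {V E' : Type*} [NormedAddCommGroup V] [NormedSpace ℝ V]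
    [NormedAddCommGroup E'] [NormedSpace ℂ E'] {H G : V → E'} {f : V → ℂ} {x₀ v : V} {a : ℂ}
    {b : E'} (hf : ContDiffAt ℝ ∞ f x₀) (hG : ContDiffAt ℝ ∞ G x₀) (hH : H = fun x => f x • G x)
    (ha : fderiv ℝ f x₀ v = a) (hb : fderiv ℝ G x₀ v = b) :
    ContDiffAt ℝ ∞ H x₀ ∧ fderiv ℝ H x₀ v = f x₀ • b + a • G x₀ := by
  subst hH
  refine ⟨hf.smul hG, ?_⟩
  rw [fderiv_fun_smul (hf.differentiableAt (by simp)) (hG.differentiableAt (by simp)), add_apply,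
    smul_apply, ContinuousLinearMap.smulRight_apply, ha, hb]

/-- **Scalar factor** (stub DICT-W4 at the adelic point `(m, c)`): for `ψ ∈ W`, the function
`m ↦ ψ(m, c)` is smooth at an invertible `m₀`, with derivative `(X ψ)(m₀, c)` along `m₀ X`
(`m_∞` and `c_f` commute). [cite: BorelJacquet1979, §1.5] -/
private theorem contDiffAt_coe_adelicPt {n : ℕ} {K : Type} [Field K] [NumberField K]
    (hcpt : isCompact_glFiniteIntegralLevel n K) (π : AutomorphicRepData (AutomorphyDatum.gl n K hcpt))
    (ψ : π.W) (c : BigHeckeGLn.FiniteAdelicGL n K)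
    {m₀ : Matrix (Fin n) (Fin n) (mixedSpace K)} (hm₀ : IsUnit m₀) :
    ContDiffAt ℝ ∞ (fun m : Matrix (Fin n) (Fin n) (mixedSpace K) =>
        (ψ : (AdelicGroupData.gl n K).Adelic → ℂ)
          (ConeDictionary.adelicPt hcpt (GLn.archOfMatrix n K m) c)) m₀ ∧
      ∀ X : (AutomorphyDatum.gl n K hcpt).arch.lie,
        fderiv ℝ (fun m : Matrix (Fin n) (Fin n) (mixedSpace K) =>
            (ψ : (AdelicGroupData.gl n K).Adelic → ℂ)
              (ConeDictionary.adelicPt hcpt (GLn.archOfMatrix n K m) c)) m₀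
            (m₀ * (X : Matrix (Fin n) (Fin n) (mixedSpace K))) =
          lieDeriv (AutomorphyDatum.gl n K hcpt).ofArch X (ψ : (AdelicGroupData.gl n K).Adelic → ℂ)
            (ConeDictionary.adelicPt hcpt (GLn.archOfMatrix n K m₀) c) := by
  have hfun : (fun m : Matrix (Fin n) (Fin n) (mixedSpace K) =>
      (ψ : (AdelicGroupData.gl n K).Adelic → ℂ)
        (ConeDictionary.adelicPt hcpt (GLn.archOfMatrix n K m) c)) =
      fun m : Matrix (Fin n) (Fin n) (mixedSpace K) =>
        (ψ : (AdelicGroupData.gl n K).Adelic → ℂ)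
          ((show (AdelicGroupData.gl n K).Adelic from GLn.ofFinite n K c) *
            (AutomorphyDatum.gl n K hcpt).ofArch
              (if h : IsUnit m then ⟨h.unit, Subgroup.mem_top _⟩ else 1)) := by
    funext m
    rw [ConeDictionary.adelicPt, ConeDictionary.ofArch_mul_ofFinite_comm]
    rfl
  have h := stub_isArchSmooth_contDiffAt_matrix hcpt (π.isArchSmooth_of_mem_W ψ.2)
    (show (AdelicGroupData.gl n K).Adelic from GLn.ofFinite n K c) hm₀
  rw [hfun, archOfMatrix_of_isUnit hm₀, ConeDictionary.adelicPt,
    ConeDictionary.ofArch_mul_ofFinite_comm]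
  exact h

/-- **Vector factor** (stub DICT-W5 for `E_λ(ℂ) ⊗ ε_S` over the datum): `m ↦ E(m) e` is smooth at an
invertible `m₀`, with derivative `E(m₀) dE(X) e` along `m₀ X`. [cite: BorelWallach2000, 0 §2.3] -/
private theorem contDiffAt_σS_apply {n : ℕ} {K : Type} [Field K] [NumberField K]
    (hcpt : isCompact_glFiniteIntegralLevel n K)
    (S : Finset {w : NumberField.InfinitePlace K // w.IsReal}) (lam : (K →+* ℂ) → Fin n → ℤ)
    (e : ResGLnCohomology.CoeffModule ℂ n K lam)
    {m₀ : Matrix (Fin n) (Fin n) (mixedSpace K)} (hm₀ : IsUnit m₀) :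
    ContDiffAt ℝ ∞ (fun m : Matrix (Fin n) (Fin n) (mixedSpace K) =>
        ConeDictionary.σS hcpt S lam (GLn.archOfMatrix n K m) e) m₀ ∧
      ∀ X : (AutomorphyDatum.gl n K hcpt).arch.lie,
        fderiv ℝ (fun m : Matrix (Fin n) (Fin n) (mixedSpace K) =>
            ConeDictionary.σS hcpt S lam (GLn.archOfMatrix n K m) e) m₀
            (m₀ * (X : Matrix (Fin n) (Fin n) (mixedSpace K))) =
          ConeDictionary.σS hcpt S lam (GLn.archOfMatrix n K m₀) (ConeDictionary.σ𝔤S hcpt lam X e) := by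
  have h := stub_isDifferentiableRep_contDiffAt_matrix (ResGLnCohomology.archCoeffRepSign n K S lam)
    (ResGLnCohomology.archCoeffLie n K lam) (ResGLnCohomology.isDifferentiableRep_archCoeffSign n K S lam)
    hm₀ e
  rw [archOfMatrix_of_isUnit hm₀]
  exact h

/-- **Stub DICT-W7 (archimedean calculus): the twisted evaluation of a FIXED tensor is smooth in the
matrix coordinates of `G_∞`, and its derivative along `m₀ X` is the twisted evaluation of the Leibniz
action of `X`**: for `t ∈ W ⊗ E_λ(ℂ)`, `m ↦ E(m) · t(m, c)` (`ConeDictionary.σS`, `adelicPt`,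
`GLn.archOfMatrix`) is smooth at every invertible `m₀`, with flat derivative along `m₀ X` equal to
`E(m₀) · ((X ⊗ 1 + 1 ⊗ dE(X)) t)(m₀, c)` (tensor induction: `stub_isArchSmooth_contDiffAt_matrix` on the
cusp functions, `stub_isDifferentiableRep_contDiffAt_matrix` on `E_λ(ℂ) ⊗ ε_S`, product rule).  This is
the identification of `D_{gX}Φ` in `stub_extDeriv_leftTrivialised` with the coefficient action of the
complex. [cite: BorelWallach2000, VII 2.2] [cite: BorelJacquet1979, §1.5] -/
theorem stub_fderiv_twistedEval {n : ℕ} {K : Type} [Field K] [NumberField K]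
    (hcpt : isCompact_glFiniteIntegralLevel n K) (π : AutomorphicRepData (AutomorphyDatum.gl n K hcpt))
    (S : Finset {w : NumberField.InfinitePlace K // w.IsReal}) (lam : (K →+* ℂ) → Fin n → ℤ)
    (t : π.W ⊗[ℂ] ResGLnCohomology.CoeffModule ℂ n K lam) (c : BigHeckeGLn.FiniteAdelicGL n K)
    {m₀ : Matrix (Fin n) (Fin n) (mixedSpace K)} (hm₀ : IsUnit m₀) :
    ContDiffAt ℝ ∞ (fun m : Matrix (Fin n) (Fin n) (mixedSpace K) =>
        ConeDictionary.σS hcpt S lam (GLn.archOfMatrix n K m)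
          (π.evalTensor (ResGLnCohomology.CoeffModule ℂ n K lam) t
            (ConeDictionary.adelicPt hcpt (GLn.archOfMatrix n K m) c))) m₀ ∧
      ∀ X : (AutomorphyDatum.gl n K hcpt).arch.lie,
        fderiv ℝ (fun m : Matrix (Fin n) (Fin n) (mixedSpace K) =>
            ConeDictionary.σS hcpt S lam (GLn.archOfMatrix n K m)
              (π.evalTensor (ResGLnCohomology.CoeffModule ℂ n K lam) t
                (ConeDictionary.adelicPt hcpt (GLn.archOfMatrix n K m) c))) m₀
            (m₀ * (X : Matrix (Fin n) (Fin n) (mixedSpace K))) =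
          ConeDictionary.σS hcpt S lam (GLn.archOfMatrix n K m₀)
            (π.evalTensor (ResGLnCohomology.CoeffModule ℂ n K lam)
              (GKTensor.lie (AutomorphyDatum.gl n K hcpt).arch π.lieRepW (ConeDictionary.σ𝔤S hcpt lam) X t)
              (ConeDictionary.adelicPt hcpt (GLn.archOfMatrix n K m₀) c)) := by
  induction t using TensorProduct.induction_on with
  | zero =>
    simp only [map_zero, Pi.zero_apply]
    exact ⟨contDiffAt_const, fun X => by simp⟩
  | tmul ψ e =>
    obtain ⟨h1, h2⟩ := contDiffAt_coe_adelicPt hcpt π ψ c hm₀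
    obtain ⟨h1', h2'⟩ := contDiffAt_σS_apply hcpt S lam e hm₀
    have hfun : (fun m : Matrix (Fin n) (Fin n) (mixedSpace K) =>
        ConeDictionary.σS hcpt S lam (GLn.archOfMatrix n K m)
          (π.evalTensor (ResGLnCohomology.CoeffModule ℂ n K lam) (ψ ⊗ₜ[ℂ] e)
            (ConeDictionary.adelicPt hcpt (GLn.archOfMatrix n K m) c))) =
        fun m : Matrix (Fin n) (Fin n) (mixedSpace K) =>
          (ψ : (AdelicGroupData.gl n K).Adelic → ℂ)
              (ConeDictionary.adelicPt hcpt (GLn.archOfMatrix n K m) c) •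
            ConeDictionary.σS hcpt S lam (GLn.archOfMatrix n K m) e := by
      funext m
      simp only [AutomorphicRepData.evalTensor_tmul, map_smul]
    have hco : ∀ X : (AutomorphyDatum.gl n K hcpt).arch.lie,
        ((π.lieRepW X ψ : π.W) : (AdelicGroupData.gl n K).Adelic → ℂ) =
          lieDeriv (AutomorphyDatum.gl n K hcpt).ofArch X
            (ψ : (AdelicGroupData.gl n K).Adelic → ℂ) := fun X => rfl
    refine ⟨(contDiffAt_fderiv_smul h1 h1' hfun rfl rfl (v := 0)).1, fun X =>
      (contDiffAt_fderiv_smul h1 h1' hfun (h2 X) (h2' X)).2.trans ?_⟩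
    simp only [GKTensor.lie_apply_tmul, map_add, Pi.add_apply, AutomorphicRepData.evalTensor_tmul,
      map_smul, hco X]
    exact add_comm _ _
  | add t t' ht ht' =>
    obtain ⟨h1, h2⟩ := ht
    obtain ⟨h1', h2'⟩ := ht'
    have hfun : (fun m : Matrix (Fin n) (Fin n) (mixedSpace K) =>
        ConeDictionary.σS hcpt S lam (GLn.archOfMatrix n K m)
          (π.evalTensor (ResGLnCohomology.CoeffModule ℂ n K lam) (t + t')
            (ConeDictionary.adelicPt hcpt (GLn.archOfMatrix n K m) c))) =
        fun m : Matrix (Fin n) (Fin n) (mixedSpace K) =>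
          ConeDictionary.σS hcpt S lam (GLn.archOfMatrix n K m)
              (π.evalTensor (ResGLnCohomology.CoeffModule ℂ n K lam) t
                (ConeDictionary.adelicPt hcpt (GLn.archOfMatrix n K m) c)) +
            ConeDictionary.σS hcpt S lam (GLn.archOfMatrix n K m)
              (π.evalTensor (ResGLnCohomology.CoeffModule ℂ n K lam) t'
                (ConeDictionary.adelicPt hcpt (GLn.archOfMatrix n K m) c)) := by
      funext m
      simp only [map_add, Pi.add_apply]
    refine ⟨(contDiffAt_fderiv_add h1 h1' hfun rfl rfl (v := 0)).1, fun X =>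
      (contDiffAt_fderiv_add h1 h1' hfun (h2 X) (h2' X)).2.trans ?_⟩
    simp only [map_add, Pi.add_apply]

end Summit.Langlands.Langlands.Theorems.HeckeEigenvalueField.Res

end
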